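import Mathlib
import HarnessLib
import Summits.ValiantsHypothesis.ValiantsHypothesis.Theorems.LacunarySymmetroidMatrixDescartesProductPlusOneSixthOrderTower

/-!
# LINE (A) `product_plus_one` (crux `MatrixDescartes`, stmt-ValiantsHypothesis-18050, V1) — W-CB, brick E3c: THE EQUAL-GAP CELL
# (`e₁ = e₂`, operator `L_eq = (θ²−a²)(θ²−4a²)(θ²−9a²)`): a window off every FAST knee's ring carries at most SIX roots of `W(∏ f_j)`

At equal gaps (`d = (d₀, d₀+a, d₀+2a)`, `a = e+1`) the row rates are `a, a, 2a`; the order-8 law `Λ₄♯` (✓/⧗ `…EighthOrderCell`) degenerates there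
(`3a²+b² = (a+b)²`; crit-1 g7 #264 (P1): the slow/middle knee images lose localisation as `s/p → 1`).  The lattice annihilator with the EXTRA root `9a²`
(pen val-idea-25 memo §28: «equal gaps (t−a²)(t−4a²)(t−9a²)») repairs it completely: for a rate-`a` row the generic order-6 image
`6(21r⁴−5e₁r²+e₂)ψ₁² + 120(14r²−e₁)ψ₁³ + 5040ψ₁⁴` (`e₁ = 14a²`, `e₂ = 49a⁴`) collapses to `5040ψ₁⁴ > 0` — BOTH knees and BOTH poles of rate `a` are
DEFINITE with no window hypothesis — and the fast pair (rate `2a`) has image `ψ₁²(630a⁴ + 5040a²ψ₁ + 5040ψ₁²)`: poles definite, the fast knee ringed.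
MENU per row: (K01) `a j 2 = 0 ∧ 0 < a j 0·a j 1` FREE; (P01) `0 ≤ f_j(u)f_j(v)`; (K12) `a j 0 = 0 ∧ 0 < a j 1·a j 2` FREE; (P12) pole;
(K02) `a j 1 = 0 ∧ 0 < a j 0·a j 2 ∧ ∀ x ∈ (u,v), 0 < 630a⁴ + 5040a²ψ₁ + 5040ψ₁²` (off its ring); (P02) pole.  THEN no seven roots of `W` in `(u,v)`
(★★ `equalGap_ringfree_no_seven_zeros`), i.e. at most six (★★ `equalGap_ringfree_wronskian_roots_le_six`).  Proof = ✓ E2a lattice shell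
`no_seven_zeros_of_sixth_order_law (e, 2e+1, 3e+2)` on the ✓ E3a tower, value `Σ_j Q_{r_j}(ψ₁ʲ) > 0` via ✓ `sixthOrder_row_value a (2a)`.
With ✓/⧗ E3b (`s ≥ 2p`), E4♯c (`p < s ≤ 2p`; at `s = p` its knee items are empty — #264 (P1)), this cell (`s = p`) and the W-mirror G6 (`s < p`), every `K = 3` support has a NON-EMPTY ring-free per-window law.

HONEST FRAMING: ONE W-cell (helper); in-ring counts NOT proved; nothing here proves `WronskianBudgetK3` / `OneChangeFloorK3` / the stubs / 18050 /
`MatrixDescartes` / Conjecture B; `VP ≠ VNP` is NOT proved.  No definitions, no named facts, no sorry; Mathlib + ✓ lane modules only.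
-/

set_option linter.dupNamespace false

namespace Summit.ValiantsHypothesis.ValiantsHypothesis.Theorems.LacunarySymmetroidMatrixDescartes

namespace ProductPlusOne

open Finset Set Polynomial
open scoped BigOperators Topology Polynomial

/-! ### §1 The summed order-6 value at equal gaps -/

/-- The order-6 value under `L_eq = (θ²−a²)(θ²−4a²)(θ²−9a²)`, summed over a binomial company with row rates `r_j ∈ {a, 2a, 3a}`, in the shell's
coefficient shapes: `S₆ − 14a²S₄ + 49a⁴S₂ − 36a⁶S₀ = Σ_j Q_{r_j}(ψ_j)` with `Q` the generic ψ-row of ✓ `sixthOrder_row_value a (2a)`. [this file's lemma] -/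
theorem equalGap_sum_value {m : ℕ} (a : ℝ) (r ψ : Fin m → ℝ) (hr : ∀ j, r j = a ∨ r j = 2 * a ∨ r j = a + 2 * a) :
    (∑ j, (r j ^ 6 * ψ j + 126 * r j ^ 4 * ψ j ^ 2 + 1680 * r j ^ 2 * ψ j ^ 3 + 5040 * ψ j ^ 4))
      - (a ^ 2 + (2 * a) ^ 2 + (3 * a) ^ 2) * (∑ j, (r j ^ 4 * ψ j + 30 * r j ^ 2 * ψ j ^ 2 + 120 * ψ j ^ 3))
      + (a ^ 2 * (2 * a) ^ 2 + a ^ 2 * (3 * a) ^ 2 + (2 * a) ^ 2 * (3 * a) ^ 2) * (∑ j, (r j ^ 2 * ψ j + 6 * ψ j ^ 2))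
      - a ^ 2 * (2 * a) ^ 2 * (3 * a) ^ 2 * (∑ j, ψ j)
    = ∑ j, (6 * (21 * r j ^ 4 - 5 * (a ^ 2 + (2 * a) ^ 2 + (a + 2 * a) ^ 2) * r j ^ 2 + (a ^ 2 * (2 * a) ^ 2 + a ^ 2 * (a + 2 * a) ^ 2 + (2 * a) ^ 2 * (a + 2 * a) ^ 2)) * ψ j ^ 2
          + 120 * (14 * r j ^ 2 - (a ^ 2 + (2 * a) ^ 2 + (a + 2 * a) ^ 2)) * ψ j ^ 3 + 5040 * ψ j ^ 4) := by
  rw [Finset.mul_sum, Finset.mul_sum, Finset.mul_sum, ← Finset.sum_sub_distrib, ← Finset.sum_add_distrib, ← Finset.sum_sub_distrib]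
  refine Finset.sum_congr rfl (fun j _ => ?_)
  have h := sixthOrder_row_value a (2 * a) (r j) (ψ j) (hr j)
  linear_combination h

/-! ### §2 Per-row facts under `L_eq` -/

/-- ★ **Per-row facts at equal gaps** (one binomial row `b`, gaps `e₁ = e₂ = e`, rate unit `a = e+1`): a rate `r ∈ {a, 2a}` (listed as
`r = a ∨ r = 2a ∨ r = a + 2a` to feed ✓ `sixthOrder_row_value a (2a)`) such that on the window the normal form is nonzero, both closure laws hold,
and the `L_eq`-image is positive: `Q_a(ψ₁) = 5040ψ₁⁴` for the four rate-`a` items (NO window hypothesis on either knee), `Q_{2a}(ψ₁) =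
ψ₁²(630a⁴ + 5040a²ψ₁ + 5040ψ₁²)` for the fast pair (pole: termwise; knee: the ring hypothesis). [this file's lemma] -/
theorem equalGap_row_facts (e : ℕ) (b : Fin 3 → ℝ) {u v : ℝ} (hu : 0 < u)
    (hrow :
      (b 2 = 0 ∧ 0 < b 0 * b 1) ∨
      (b 2 = 0 ∧ b 0 * b 1 < 0 ∧ 0 ≤ (b 0 + b 1 * u ^ (e + 1) + b 2 * u ^ (e + e + 2)) * (b 0 + b 1 * v ^ (e + 1) + b 2 * v ^ (e + e + 2))) ∨
      (b 0 = 0 ∧ 0 < b 1 * b 2) ∨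
      (b 0 = 0 ∧ b 1 * b 2 < 0 ∧ 0 ≤ (b 0 + b 1 * u ^ (e + 1) + b 2 * u ^ (e + e + 2)) * (b 0 + b 1 * v ^ (e + 1) + b 2 * v ^ (e + e + 2))) ∨
      (b 1 = 0 ∧ 0 < b 0 * b 2 ∧ ∀ x ∈ Ioo u v, 0 < 630 * ((e : ℝ) + 1) ^ 4 + 5040 * ((e : ℝ) + 1) ^ 2 * rowPsi1 e e (b 0) (-(b 1)) (-(b 2)) x + 5040 * rowPsi1 e e (b 0) (-(b 1)) (-(b 2)) x ^ 2) ∨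
      (b 1 = 0 ∧ b 0 * b 2 < 0 ∧ 0 ≤ (b 0 + b 1 * u ^ (e + 1) + b 2 * u ^ (e + e + 2)) * (b 0 + b 1 * v ^ (e + 1) + b 2 * v ^ (e + e + 2)))) :
    ∃ r : ℝ, (r = ((e : ℝ) + 1) ∨ r = 2 * ((e : ℝ) + 1) ∨ r = ((e : ℝ) + 1) + 2 * ((e : ℝ) + 1)) ∧ ∀ x ∈ Ioo u v,
      b 0 - (-(b 1)) * x ^ (e + 1) - (-(b 2)) * x ^ (e + e + 2) ≠ 0 ∧
      rowPsi3 e e (b 0) (-(b 1)) (-(b 2)) x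
        = r ^ 2 * rowPsi1 e e (b 0) (-(b 1)) (-(b 2)) x + 6 * rowPsi1 e e (b 0) (-(b 1)) (-(b 2)) x ^ 2 ∧
      rowPsi2 e e (b 0) (-(b 1)) (-(b 2)) x ^ 2
        = r ^ 2 * rowPsi1 e e (b 0) (-(b 1)) (-(b 2)) x ^ 2 + 4 * rowPsi1 e e (b 0) (-(b 1)) (-(b 2)) x ^ 3 ∧
      0 < 6 * (21 * r ^ 4 - 5 * (((e : ℝ) + 1) ^ 2 + (2 * ((e : ℝ) + 1)) ^ 2 + (((e : ℝ) + 1) + 2 * ((e : ℝ) + 1)) ^ 2) * r ^ 2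
              + (((e : ℝ) + 1) ^ 2 * (2 * ((e : ℝ) + 1)) ^ 2 + ((e : ℝ) + 1) ^ 2 * (((e : ℝ) + 1) + 2 * ((e : ℝ) + 1)) ^ 2 + (2 * ((e : ℝ)
                      + 1)) ^ 2 * (((e : ℝ) + 1) + 2 * ((e : ℝ) + 1)) ^ 2)) * rowPsi1 e e (b 0) (-(b 1)) (-(b 2)) x ^ 2
          + 120 * (14 * r ^ 2 - (((e : ℝ) + 1) ^ 2 + (2 * ((e : ℝ) + 1)) ^ 2 + (((e : ℝ) + 1) + 2 * ((e : ℝ)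
                  + 1)) ^ 2)) * rowPsi1 e e (b 0) (-(b 1)) (-(b 2)) x ^ 3 + 5040 * rowPsi1 e e (b 0) (-(b 1)) (-(b 2)) x ^ 4 := by
  have ha0 : 0 < ((e : ℝ) + 1) := by positivity
  have huv_pos : ∀ x ∈ Ioo u v, 0 < x := fun x hx => hu.trans hx.1
  -- the two image identities
  have hQa : ∀ ψ : ℝ, 6 * (21 * ((e : ℝ) + 1) ^ 4 - 5 * (((e : ℝ) + 1) ^ 2 + (2 * ((e : ℝ) + 1)) ^ 2 + (((e : ℝ) + 1) + 2 * ((e : ℝ) + 1)) ^ 2) * ((e : ℝ) + 1) ^ 2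
              + (((e : ℝ) + 1) ^ 2 * (2 * ((e : ℝ) + 1)) ^ 2 + ((e : ℝ) + 1) ^ 2 * (((e : ℝ) + 1) + 2 * ((e : ℝ) + 1)) ^ 2 + (2 * ((e : ℝ) + 1)) ^ 2 * (((e : ℝ) + 1) + 2 * ((e : ℝ) + 1)) ^ 2)) * ψ ^ 2
          + 120 * (14 * ((e : ℝ) + 1) ^ 2 - (((e : ℝ) + 1) ^ 2 + (2 * ((e : ℝ) + 1)) ^ 2 + (((e : ℝ) + 1) + 2 * ((e : ℝ) + 1)) ^ 2)) * ψ ^ 3 + 5040 * ψ ^ 4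
      = 5040 * (ψ ^ 2 * ψ ^ 2) := by intro ψ; ring
  have hQ2a : ∀ ψ : ℝ, 6 * (21 * (2 * ((e : ℝ) + 1)) ^ 4 - 5 * (((e : ℝ) + 1) ^ 2 + (2 * ((e : ℝ) + 1)) ^ 2 + (((e : ℝ) + 1) + 2 * ((e : ℝ) + 1)) ^ 2) * (2 * ((e : ℝ) + 1)) ^ 2
              + (((e : ℝ) + 1) ^ 2 * (2 * ((e : ℝ) + 1)) ^ 2 + ((e : ℝ) + 1) ^ 2 * (((e : ℝ) + 1) + 2 * ((e : ℝ) + 1)) ^ 2 + (2 * ((e : ℝ) + 1)) ^ 2 * (((e : ℝ) + 1) + 2 * ((e : ℝ) + 1)) ^ 2)) * ψ ^ 2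
          + 120 * (14 * (2 * ((e : ℝ) + 1)) ^ 2 - (((e : ℝ) + 1) ^ 2 + (2 * ((e : ℝ) + 1)) ^ 2 + (((e : ℝ) + 1) + 2 * ((e : ℝ) + 1)) ^ 2)) * ψ ^ 3 + 5040 * ψ ^ 4
      = ψ ^ 2 * (630 * ((e : ℝ) + 1) ^ 4 + 5040 * ((e : ℝ) + 1) ^ 2 * ψ + 5040 * ψ ^ 2) := by intro ψ; ring
  rcases hrow with ⟨h2, hsgn⟩ | ⟨h2, hsgn, hend⟩ | ⟨h0, hsgn⟩ | ⟨h0, hsgn, hend⟩ | ⟨h1, hsgn, hring⟩ | ⟨h1, hsgn, hend⟩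
  · -- (K01) knee of the lower pair, rate a: free
    refine ⟨((e : ℝ) + 1), Or.inl rfl, fun x hx => ?_⟩
    have hx0 := huv_pos x hx
    have hn2 : -(b 2) = 0 := by rw [h2, neg_zero]
    have hAB : b 0 * (-(b 1)) < 0 := by nlinarith
    have hψ := pair01_knee_rowPsi1_neg e e (b 0) (-(b 1)) hx0 hAB
    have hF : b 0 - (-(b 1)) * x ^ (e + 1) ≠ 0 := by
      intro h
      have hA : b 0 = -(b 1) * x ^ (e + 1) := by linarith
      rw [hA] at hAB
      nlinarith [sq_nonneg (b 1), pow_pos hx0 (e + 1)]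
    rw [hn2]
    refine ⟨by rwa [zero_mul, sub_zero], ?_, ?_, ?_⟩
    · have h := pair01_rowPsi3_law e e (b 0) (-(b 1)) x
      linear_combination h
    · have h := pair01_rowPsi2_sq e e (b 0) (-(b 1)) x
      linear_combination h
    · rw [hQa]
      have hψne : rowPsi1 e e (b 0) (-(b 1)) 0 x ≠ 0 := hψ.ne
      positivity
  · -- (P01) pole of the lower pair, rate a
    refine ⟨((e : ℝ) + 1), Or.inl rfl, fun x hx => ?_⟩
    have hx0 := huv_pos x hx
    have hn2 : -(b 2) = 0 := by rw [h2, neg_zero]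
    have hb1 : b 1 ≠ 0 := by rintro h; rw [h, mul_zero] at hsgn; exact lt_irrefl _ hsgn
    have hend' : 0 ≤ (b 0 + b 1 * u ^ (e + 1)) * (b 0 + b 1 * v ^ (e + 1)) := by
      rw [h2] at hend; simpa using hend
    have hne : b 0 + b 1 * x ^ (e + 1) ≠ 0 :=
      binomial_ne_zero_of_endpoints (b 0) (b 1) (Nat.succ_ne_zero e) hu hx hend' hb1
    have hF : b 0 - (-(b 1)) * x ^ (e + 1) ≠ 0 := by
      have : b 0 - (-(b 1)) * x ^ (e + 1) = b 0 + b 1 * x ^ (e + 1) := by ring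
      rwa [this]
    have hψ : 0 < rowPsi1 e e (b 0) (-(b 1)) 0 x := pair01_pole_rowPsi1_pos e e (b 0) (-(b 1)) hx0 (by nlinarith) hF
    rw [hn2]
    refine ⟨by rwa [zero_mul, sub_zero], ?_, ?_, ?_⟩
    · have h := pair01_rowPsi3_law e e (b 0) (-(b 1)) x
      linear_combination h
    · have h := pair01_rowPsi2_sq e e (b 0) (-(b 1)) x
      linear_combination h
    · rw [hQa]
      positivity
  · -- (K12) knee of the upper pair, rate a (equal gaps): free
    refine ⟨((e : ℝ) + 1), Or.inl rfl, fun x hx => ?_⟩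
    have hx0 := huv_pos x hx
    have hBC : 0 < (-(b 1)) * (-(b 2)) := by nlinarith
    have hψ := pair12_knee_rowPsi1_neg e e (-(b 1)) (-(b 2)) hx0 hBC
    have hsame : b 1 + b 2 * x ^ (e + 1) ≠ 0 := by
      intro h
      have : b 1 * (b 1 + b 2 * x ^ (e + 1)) = 0 := by rw [h, mul_zero]
      nlinarith [mul_self_nonneg (b 1), mul_pos hsgn (pow_pos hx0 (e + 1))]
    have hF : (0 : ℝ) - (-(b 1)) * x ^ (e + 1) - (-(b 2)) * x ^ (e + e + 2) ≠ 0 := by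
      have : (0 : ℝ) - (-(b 1)) * x ^ (e + 1) - (-(b 2)) * x ^ (e + e + 2) = x ^ (e + 1) * (b 1 + b 2 * x ^ (e + 1)) := by ring
      rw [this]; exact mul_ne_zero (pow_ne_zero _ hx0.ne') hsame
    rw [h0]
    refine ⟨hF, ?_, ?_, ?_⟩
    · have h := pair12_rowPsi3_law e e (-(b 1)) (-(b 2)) hF
      linear_combination h
    · have h := pair12_rowPsi2_sq e e (-(b 1)) (-(b 2)) hF
      linear_combination h
    · rw [hQa]
      have hψne : rowPsi1 e e 0 (-(b 1)) (-(b 2)) x ≠ 0 := hψ.ne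
      positivity
  · -- (P12) pole of the upper pair, rate a
    refine ⟨((e : ℝ) + 1), Or.inl rfl, fun x hx => ?_⟩
    have hx0 := huv_pos x hx
    have hv : 0 < v := hu.trans (hx.1.trans hx.2)
    have hb2 : b 2 ≠ 0 := by rintro h; rw [h, mul_zero] at hsgn; exact lt_irrefl _ hsgn
    have hend' : 0 ≤ (b 1 + b 2 * u ^ (e + 1)) * (b 1 + b 2 * v ^ (e + 1)) := by
      rw [h0] at hend
      have hfac : (0 + b 1 * u ^ (e + 1) + b 2 * u ^ (e + e + 2)) * (0 + b 1 * v ^ (e + 1) + b 2 * v ^ (e + e + 2))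
          = (u ^ (e + 1) * v ^ (e + 1)) * ((b 1 + b 2 * u ^ (e + 1)) * (b 1 + b 2 * v ^ (e + 1))) := by ring
      rw [hfac] at hend
      exact (mul_nonneg_iff_of_pos_left (mul_pos (pow_pos hu _) (pow_pos hv _))).1 hend
    have hne : b 1 + b 2 * x ^ (e + 1) ≠ 0 :=
      binomial_ne_zero_of_endpoints (b 1) (b 2) (Nat.succ_ne_zero _) hu hx hend' hb2
    have hF : (0 : ℝ) - (-(b 1)) * x ^ (e + 1) - (-(b 2)) * x ^ (e + e + 2) ≠ 0 := by
      have : (0 : ℝ) - (-(b 1)) * x ^ (e + 1) - (-(b 2)) * x ^ (e + e + 2) = x ^ (e + 1) * (b 1 + b 2 * x ^ (e + 1)) := by ring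
      rw [this]; exact mul_ne_zero (pow_ne_zero _ hx0.ne') hne
    have hψ : 0 < rowPsi1 e e 0 (-(b 1)) (-(b 2)) x := pair12_pole_rowPsi1_pos e e (-(b 1)) (-(b 2)) hx0 (by nlinarith) hF
    rw [h0]
    refine ⟨hF, ?_, ?_, ?_⟩
    · have h := pair12_rowPsi3_law e e (-(b 1)) (-(b 2)) hF
      linear_combination h
    · have h := pair12_rowPsi2_sq e e (-(b 1)) (-(b 2)) hF
      linear_combination h
    · rw [hQa]
      positivity
  · -- (K02) fast knee, rate 2a: ring off the window
    refine ⟨2 * ((e : ℝ) + 1), Or.inr (Or.inl rfl), fun x hx => ?_⟩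
    have hx0 := huv_pos x hx
    have hn1 : -(b 1) = 0 := by rw [h1, neg_zero]
    have hAC : b 0 * (-(b 2)) < 0 := by nlinarith
    have hψ := knee_rowPsi1_neg e e (b 0) (-(b 2)) hx0 hAC
    have hF : b 0 - (-(b 2)) * x ^ (e + e + 2) ≠ 0 := by
      intro h
      have hA : b 0 = -(b 2) * x ^ (e + e + 2) := by linarith
      rw [hA] at hAC
      nlinarith [sq_nonneg (b 2), pow_pos hx0 (e + e + 2)]
    have hq := hring x hx
    rw [hn1] at hq ⊢
    refine ⟨by rwa [zero_mul, sub_zero], ?_, ?_, ?_⟩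
    · have h := pair02_rowPsi3_law e e (b 0) (-(b 2)) x
      linear_combination h
    · have h := pair02_rowPsi2_sq e e (b 0) (-(b 2)) x
      linear_combination h
    · rw [hQ2a]
      have hψne : rowPsi1 e e (b 0) 0 (-(b 2)) x ≠ 0 := hψ.ne
      exact mul_pos (by positivity) hq
  · -- (P02) fast pole, rate 2a
    refine ⟨2 * ((e : ℝ) + 1), Or.inr (Or.inl rfl), fun x hx => ?_⟩
    have hx0 := huv_pos x hx
    have hn1 : -(b 1) = 0 := by rw [h1, neg_zero]
    have hb2 : b 2 ≠ 0 := by rintro h; rw [h, mul_zero] at hsgn; exact lt_irrefl _ hsgn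
    have hend' : 0 ≤ (b 0 + b 2 * u ^ (e + e + 2)) * (b 0 + b 2 * v ^ (e + e + 2)) := by
      rw [h1] at hend; simpa using hend
    have hne : b 0 + b 2 * x ^ (e + e + 2) ≠ 0 :=
      binomial_ne_zero_of_endpoints (b 0) (b 2) (Nat.succ_ne_zero _) hu hx hend' hb2
    have hF : b 0 - (-(b 2)) * x ^ (e + e + 2) ≠ 0 := by
      have : b 0 - (-(b 2)) * x ^ (e + e + 2) = b 0 + b 2 * x ^ (e + e + 2) := by ring
      rwa [this]
    have hψ : 0 < rowPsi1 e e (b 0) 0 (-(b 2)) x := pair02_pole_rowPsi1_pos e e (b 0) (-(b 2)) hx0 (by nlinarith) hF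
    rw [hn1]
    refine ⟨by rwa [zero_mul, sub_zero], ?_, ?_, ?_⟩
    · have h := pair02_rowPsi3_law e e (b 0) (-(b 2)) x
      linear_combination h
    · have h := pair02_rowPsi2_sq e e (b 0) (-(b 2)) x
      linear_combination h
    · rw [hQ2a]
      exact mul_pos (by positivity) (by positivity)

/-! ### §3 The equal-gap cell -/

/-- ★★ **THE EQUAL-GAP LOCALISATION CELL, chain form** (see the module docstring for the menu). [this file's theorem] -/
theorem equalGap_ringfree_no_seven_zeros {m : ℕ} (hm : 0 < m) (d : Fin 3 → ℕ) (e : ℕ) (he₁ : d 1 = d 0 + e + 1)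
    (he₂ : d 2 = d 1 + e + 1) (a : Fin m → Fin 3 → ℝ) {u v : ℝ} (hu : 0 < u)
    (hrow : ∀ j,
      (a j 2 = 0 ∧ 0 < a j 0 * a j 1) ∨
      (a j 2 = 0 ∧ a j 0 * a j 1 < 0 ∧ 0 ≤ (∑ l, C (a j l) * X ^ (d l) : ℝ[X]).eval u * (∑ l, C (a j l) * X ^ (d l) : ℝ[X]).eval v) ∨
      (a j 0 = 0 ∧ 0 < a j 1 * a j 2) ∨
      (a j 0 = 0 ∧ a j 1 * a j 2 < 0 ∧ 0 ≤ (∑ l, C (a j l) * X ^ (d l) : ℝ[X]).eval u * (∑ l, C (a j l) * X ^ (d l) : ℝ[X]).eval v) ∨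
      (a j 1 = 0 ∧ 0 < a j 0 * a j 2 ∧ ∀ x ∈ Ioo u v,
          0 < 630 * ((e : ℝ) + 1) ^ 4 + 5040 * ((e : ℝ) + 1) ^ 2 * rowPsi1 e e (a j 0) (-(a j 1)) (-(a j 2)) x + 5040 * rowPsi1 e e (a j 0) (-(a j 1)) (-(a j 2)) x ^ 2) ∨
      (a j 1 = 0 ∧ a j 0 * a j 2 < 0 ∧ 0 ≤ (∑ l, C (a j l) * X ^ (d l) : ℝ[X]).eval u * (∑ l, C (a j l) * X ^ (d l) : ℝ[X]).eval v))
    (x : Fin 7 → ℝ) (hx : StrictMono x) (hxI : ∀ i, x i ∈ Ioo u v)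
    (hzero : ∀ i, ((∏ j, ∑ l, C (a j l) * X ^ (d l) : ℝ[X]) * (X * derivative (X * derivative (∏ j, ∑ l, C (a j l) * X ^ (d l) : ℝ[X])))
        - (X * derivative (∏ j, ∑ l, C (a j l) * X ^ (d l) : ℝ[X])) ^ 2).eval (x i) = 0) : False := by
  classical
  have hd := fin3_support_eq_gaps d e e he₁ he₂
  have hev : ∀ j x, (∑ l, C (a j l) * X ^ (d l) : ℝ[X]).eval x
      = x ^ (d 0) * (a j 0 + a j 1 * x ^ (e + 1) + a j 2 * x ^ (e + e + 2)) := by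
    intro j x
    have h := (eval_trinomial_three (d 0) (e + 1) (e + e + 2) (a j) x).1
    rw [hd] at h; rw [h]; ring
  have huv : u < v := (hxI 0).1.trans (hxI 0).2
  have hv : 0 < v := hu.trans huv
  -- the endpoint product of `f_j` controls the stripped row
  have hstrip : ∀ j, 0 ≤ (∑ l, C (a j l) * X ^ (d l) : ℝ[X]).eval u * (∑ l, C (a j l) * X ^ (d l) : ℝ[X]).eval v →
      0 ≤ (a j 0 + a j 1 * u ^ (e + 1) + a j 2 * u ^ (e + e + 2)) * (a j 0 + a j 1 * v ^ (e + 1) + a j 2 * v ^ (e + e + 2)) := by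
    intro j h
    rw [hev, hev] at h
    have hpow : 0 < u ^ (d 0) * v ^ (d 0) := mul_pos (pow_pos hu _) (pow_pos hv _)
    have : u ^ (d 0) * (a j 0 + a j 1 * u ^ (e + 1) + a j 2 * u ^ (e + e + 2))
        * (v ^ (d 0) * (a j 0 + a j 1 * v ^ (e + 1) + a j 2 * v ^ (e + e + 2)))
        = (u ^ (d 0) * v ^ (d 0)) * ((a j 0 + a j 1 * u ^ (e + 1) + a j 2 * u ^ (e + e + 2)) * (a j 0 + a j 1 * v ^ (e + 1) + a j 2 * v ^ (e + e + 2))) := by ring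
    rw [this] at h
    exact (mul_nonneg_iff_of_pos_left hpow).1 h
  -- per-row facts
  have hfacts : ∀ j, _ := fun j => equalGap_row_facts e (a j) hu (by
    rcases hrow j with h | ⟨h2, hs', hend⟩ | h | ⟨h0, hs', hend⟩ | h | ⟨h1, hs', hend⟩
    · exact Or.inl h
    · exact Or.inr (Or.inl ⟨h2, hs', hstrip j hend⟩)
    · exact Or.inr (Or.inr (Or.inl h))
    · exact Or.inr (Or.inr (Or.inr (Or.inl ⟨h0, hs', hstrip j hend⟩)))
    · exact Or.inr (Or.inr (Or.inr (Or.inr (Or.inl h))))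
    · exact Or.inr (Or.inr (Or.inr (Or.inr (Or.inr ⟨h1, hs', hstrip j hend⟩)))))
  choose r hr using hfacts
  -- shorthand for the rows' tower values
  have hF : ∀ j, ∀ x ∈ Ioo u v, a j 0 - (-(a j 1)) * x ^ (e + 1) - (-(a j 2)) * x ^ (e + e + 2) ≠ 0 :=
    fun j x hx => ((hr j).2 x hx).1
  have hL3 : ∀ j, ∀ x ∈ Ioo u v, rowPsi3 e e (a j 0) (-(a j 1)) (-(a j 2)) x
      = r j ^ 2 * rowPsi1 e e (a j 0) (-(a j 1)) (-(a j 2)) x + 6 * rowPsi1 e e (a j 0) (-(a j 1)) (-(a j 2)) x ^ 2 :=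
    fun j x hx => ((hr j).2 x hx).2.1
  have hL2 : ∀ j, ∀ x ∈ Ioo u v, rowPsi2 e e (a j 0) (-(a j 1)) (-(a j 2)) x ^ 2
      = r j ^ 2 * rowPsi1 e e (a j 0) (-(a j 1)) (-(a j 2)) x ^ 2 + 4 * rowPsi1 e e (a j 0) (-(a j 1)) (-(a j 2)) x ^ 3 :=
    fun j x hx => ((hr j).2 x hx).2.2.1
  have hQ : ∀ j, ∀ x ∈ Ioo u v, 0 < 6 * (21 * r j ^ 4 - 5 * (((e : ℝ) + 1) ^ 2 + (2 * ((e : ℝ) + 1)) ^ 2 + (((e : ℝ) + 1) + 2 * ((e : ℝ) + 1)) ^ 2) * r j ^ 2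
              + (((e : ℝ) + 1) ^ 2 * (2 * ((e : ℝ) + 1)) ^ 2 + ((e : ℝ) + 1) ^ 2 * (((e : ℝ) + 1) + 2 * ((e : ℝ) + 1)) ^ 2 + (2 * ((e : ℝ)
                      + 1)) ^ 2 * (((e : ℝ) + 1) + 2 * ((e : ℝ) + 1)) ^ 2)) * rowPsi1 e e (a j 0) (-(a j 1)) (-(a j 2)) x ^ 2
          + 120 * (14 * r j ^ 2 - (((e : ℝ) + 1) ^ 2 + (2 * ((e : ℝ) + 1)) ^ 2 + (((e : ℝ) + 1) + 2 * ((e : ℝ)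
                  + 1)) ^ 2)) * rowPsi1 e e (a j 0) (-(a j 1)) (-(a j 2)) x ^ 3 + 5040 * rowPsi1 e e (a j 0) (-(a j 1)) (-(a j 2)) x ^ 4 :=
    fun j x hx => ((hr j).2 x hx).2.2.2
  have hrate : ∀ j, r j = ((e : ℝ) + 1) ∨ r j = 2 * ((e : ℝ) + 1) ∨ r j = ((e : ℝ) + 1) + 2 * ((e : ℝ) + 1) := fun j => (hr j).1
  have hx0 : ∀ x ∈ Ioo u v, (x : ℝ) ≠ 0 := fun x hx => (hu.trans hx.1).ne'
  -- no row vanishes on the window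
  have hf : ∀ x ∈ Ioo u v, ∀ j, (∑ l, C (a j l) * X ^ (d l) : ℝ[X]).eval x ≠ 0 := by
    intro x hx j
    rw [hev]
    have : a j 0 + a j 1 * x ^ (e + 1) + a j 2 * x ^ (e + e + 2)
        = a j 0 - (-(a j 1)) * x ^ (e + 1) - (-(a j 2)) * x ^ (e + e + 2) := by ring
    rw [this]
    exact mul_ne_zero (pow_ne_zero _ (hx0 x hx)) (hF j x hx)
  -- the zeros of `W` in the window are zeros of `S₀ = Σψ₁`
  have hS0 : ∀ i, (∑ j, rowPsi1 e e (a j 0) (-(a j 1)) (-(a j 2)) (x i)) = 0 := by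
    intro i
    have hxi := hxI i
    have hxpos : 0 < x i := hu.trans hxi.1
    have h := hzero i
    rw [logWronskian_prod_eq_rowPsi1_sum d e e he₁ he₂ a hxpos (hf (x i) hxi)] at h
    have hP : ((∏ j, (∑ l, C (a j l) * X ^ (d l) : ℝ[X])).eval (x i)) ≠ 0 := by
      rw [eval_prod]; exact Finset.prod_ne_zero_iff.2 fun j _ => hf (x i) hxi j
    rcases mul_eq_zero.1 h with h1 | h1
    · exact absurd (neg_eq_zero.1 h1) (pow_ne_zero 2 hP)
    · exact h1
  -- the tower and its derivatives
  have h0 : ∀ x ∈ Ioo u v, HasDerivAt (fun t => ∑ j, rowPsi1 e e (a j 0) (-(a j 1)) (-(a j 2)) t)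
      ((∑ j, rowPsi2 e e (a j 0) (-(a j 1)) (-(a j 2)) x) / x) x := by
    intro x hx
    have h := HasDerivAt.fun_sum (u := Finset.univ)
      (fun j _ => hasDerivAt_rowPsi1 e e (a j 0) (-(a j 1)) (-(a j 2)) (hx0 x hx) (hF j x hx))
    simpa only [Finset.sum_div] using h
  have h1 : ∀ x ∈ Ioo u v, HasDerivAt (fun t => ∑ j, rowPsi2 e e (a j 0) (-(a j 1)) (-(a j 2)) t)
      ((∑ j, (r j ^ 2 * rowPsi1 e e (a j 0) (-(a j 1)) (-(a j 2)) x + 6 * rowPsi1 e e (a j 0) (-(a j 1)) (-(a j 2)) x ^ 2)) / x) x := by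
    intro x hx
    have h := HasDerivAt.fun_sum (u := Finset.univ)
      (fun j _ => hasDerivAt_rowPsi2 e e (a j 0) (-(a j 1)) (-(a j 2)) (hx0 x hx) (hF j x hx))
    refine (h.congr_deriv ?_)
    rw [Finset.sum_div]
    exact Finset.sum_congr rfl (fun j _ => by rw [hL3 j x hx])
  have h2 : ∀ x ∈ Ioo u v, HasDerivAt
      (fun t => ∑ j, (r j ^ 2 * rowPsi1 e e (a j 0) (-(a j 1)) (-(a j 2)) t + 6 * rowPsi1 e e (a j 0) (-(a j 1)) (-(a j 2)) t ^ 2))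
      ((∑ j, (r j ^ 2 + 12 * rowPsi1 e e (a j 0) (-(a j 1)) (-(a j 2)) x) * rowPsi2 e e (a j 0) (-(a j 1)) (-(a j 2)) x) / x) x := by
    intro x hx
    have h := HasDerivAt.fun_sum (u := Finset.univ)
      (fun j _ => hasDerivAt_tower2 e e (a j 0) (-(a j 1)) (-(a j 2)) (r j) (hx0 x hx) (hF j x hx))
    simpa only [Finset.sum_div] using h
  have h3 : ∀ x ∈ Ioo u v, HasDerivAt
      (fun t => ∑ j, (r j ^ 2 + 12 * rowPsi1 e e (a j 0) (-(a j 1)) (-(a j 2)) t) * rowPsi2 e e (a j 0) (-(a j 1)) (-(a j 2)) t)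
      ((∑ j, (r j ^ 4 * rowPsi1 e e (a j 0) (-(a j 1)) (-(a j 2)) x + 30 * r j ^ 2 * rowPsi1 e e (a j 0) (-(a j 1)) (-(a j 2)) x ^ 2
        + 120 * rowPsi1 e e (a j 0) (-(a j 1)) (-(a j 2)) x ^ 3)) / x) x := by
    intro x hx
    have h := HasDerivAt.fun_sum (u := Finset.univ)
      (fun j _ => hasDerivAt_tower3 e e (a j 0) (-(a j 1)) (-(a j 2)) (r j) (hx0 x hx) (hF j x hx) (hL2 j x hx) (hL3 j x hx))
    simpa only [Finset.sum_div] using h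
  have h4 : ∀ x ∈ Ioo u v, HasDerivAt
      (fun t => ∑ j, (r j ^ 4 * rowPsi1 e e (a j 0) (-(a j 1)) (-(a j 2)) t + 30 * r j ^ 2 * rowPsi1 e e (a j 0) (-(a j 1)) (-(a j 2)) t ^ 2
        + 120 * rowPsi1 e e (a j 0) (-(a j 1)) (-(a j 2)) t ^ 3))
      ((∑ j, (r j ^ 4 + 60 * r j ^ 2 * rowPsi1 e e (a j 0) (-(a j 1)) (-(a j 2)) x + 360 * rowPsi1 e e (a j 0) (-(a j 1)) (-(a j 2)) x ^ 2)
        * rowPsi2 e e (a j 0) (-(a j 1)) (-(a j 2)) x) / x) x := by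
    intro x hx
    have h := HasDerivAt.fun_sum (u := Finset.univ)
      (fun j _ => hasDerivAt_tower4 e e (a j 0) (-(a j 1)) (-(a j 2)) (r j) (hx0 x hx) (hF j x hx))
    simpa only [Finset.sum_div] using h
  have h5 : ∀ x ∈ Ioo u v, HasDerivAt
      (fun t => ∑ j, (r j ^ 4 + 60 * r j ^ 2 * rowPsi1 e e (a j 0) (-(a j 1)) (-(a j 2)) t + 360 * rowPsi1 e e (a j 0) (-(a j 1)) (-(a j 2)) t ^ 2)
        * rowPsi2 e e (a j 0) (-(a j 1)) (-(a j 2)) t)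
      ((∑ j, (r j ^ 6 * rowPsi1 e e (a j 0) (-(a j 1)) (-(a j 2)) x + 126 * r j ^ 4 * rowPsi1 e e (a j 0) (-(a j 1)) (-(a j 2)) x ^ 2
        + 1680 * r j ^ 2 * rowPsi1 e e (a j 0) (-(a j 1)) (-(a j 2)) x ^ 3 + 5040 * rowPsi1 e e (a j 0) (-(a j 1)) (-(a j 2)) x ^ 4)) / x) x := by
    intro x hx
    have h := HasDerivAt.fun_sum (u := Finset.univ)
      (fun j _ => hasDerivAt_tower5 e e (a j 0) (-(a j 1)) (-(a j 2)) (r j) (hx0 x hx) (hF j x hx) (hL2 j x hx) (hL3 j x hx))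
    simpa only [Finset.sum_div] using h
  -- the order-6 value is `Σ_j Q_(r_j)(ψ₁ʲ) > 0`
  have hq2 : ((2 * e + 1 : ℕ) : ℝ) + 1 = 2 * ((e : ℝ) + 1) := by push_cast; ring
  have hq3 : ((3 * e + 2 : ℕ) : ℝ) + 1 = 3 * ((e : ℝ) + 1) := by push_cast; ring
  refine no_seven_zeros_of_sixth_order_law e (2 * e + 1) (3 * e + 2) hu.le h0 h1 h2 h3 h4 h5 ?_ x hx hxI hS0
  intro x hx
  rw [hq2, hq3]
  have hval := equalGap_sum_value ((e : ℝ) + 1) r (fun j => rowPsi1 e e (a j 0) (-(a j 1)) (-(a j 2)) x) hrate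
  have hpos := Finset.sum_pos (fun j (_ : j ∈ (Finset.univ : Finset (Fin m))) => hQ j x hx) ⟨⟨0, hm⟩, Finset.mem_univ _⟩
  rw [← hval] at hpos
  exact hpos.ne'

/-- ★★ **THE EQUAL-GAP LOCALISATION CELL, count form**: under the same hypotheses, `W(∏_j f_j)` has AT MOST SIX roots in `(u,v)`. [this file's theorem] -/
theorem equalGap_ringfree_wronskian_roots_le_six {m : ℕ} (d : Fin 3 → ℕ) (e : ℕ) (he₁ : d 1 = d 0 + e + 1)
    (he₂ : d 2 = d 1 + e + 1) (a : Fin m → Fin 3 → ℝ) {u v : ℝ} (hu : 0 < u)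
    (hrow : ∀ j,
      (a j 2 = 0 ∧ 0 < a j 0 * a j 1) ∨
      (a j 2 = 0 ∧ a j 0 * a j 1 < 0 ∧ 0 ≤ (∑ l, C (a j l) * X ^ (d l) : ℝ[X]).eval u * (∑ l, C (a j l) * X ^ (d l) : ℝ[X]).eval v) ∨
      (a j 0 = 0 ∧ 0 < a j 1 * a j 2) ∨
      (a j 0 = 0 ∧ a j 1 * a j 2 < 0 ∧ 0 ≤ (∑ l, C (a j l) * X ^ (d l) : ℝ[X]).eval u * (∑ l, C (a j l) * X ^ (d l) : ℝ[X]).eval v) ∨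
      (a j 1 = 0 ∧ 0 < a j 0 * a j 2 ∧ ∀ x ∈ Ioo u v,
          0 < 630 * ((e : ℝ) + 1) ^ 4 + 5040 * ((e : ℝ) + 1) ^ 2 * rowPsi1 e e (a j 0) (-(a j 1)) (-(a j 2)) x + 5040 * rowPsi1 e e (a j 0) (-(a j 1)) (-(a j 2)) x ^ 2) ∨
      (a j 1 = 0 ∧ a j 0 * a j 2 < 0 ∧ 0 ≤ (∑ l, C (a j l) * X ^ (d l) : ℝ[X]).eval u * (∑ l, C (a j l) * X ^ (d l) : ℝ[X]).eval v)) :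
    (((∏ j, ∑ l, C (a j l) * X ^ (d l) : ℝ[X]) * (X * derivative (X * derivative (∏ j, ∑ l, C (a j l) * X ^ (d l) : ℝ[X])))
        - (X * derivative (∏ j, ∑ l, C (a j l) * X ^ (d l) : ℝ[X])) ^ 2).roots.toFinset.filter (fun t => u < t ∧ t < v)).card ≤ 6 := by
  classical
  set Wp : ℝ[X] := ((∏ j, ∑ l, C (a j l) * X ^ (d l) : ℝ[X]) * (X * derivative (X * derivative (∏ j, ∑ l, C (a j l) * X ^ (d l) : ℝ[X])))
        - (X * derivative (∏ j, ∑ l, C (a j l) * X ^ (d l) : ℝ[X])) ^ 2) with hWdef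
  set T := Wp.roots.toFinset.filter (fun t => u < t ∧ t < v) with hT
  by_contra hgt
  push Not at hgt
  by_cases hW0 : Wp = 0
  · have : T = ∅ := by rw [hT, hW0, roots_zero, Multiset.toFinset_zero, Finset.filter_empty]
    rw [this, Finset.card_empty] at hgt; exact absurd hgt (by norm_num)
  have hm : 0 < m := by
    rcases Nat.eq_zero_or_pos m with h0 | hpos
    · subst h0
      exact absurd (by rw [hWdef]; simp) hW0
    · exact hpos
  obtain ⟨T', hT'T, hcard⟩ := Finset.exists_subset_card_eq (show 7 ≤ T.card by omega)
  set x : Fin 7 → ℝ := fun i => T'.orderEmbOfFin hcard i with hxdef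
  have hxmono : StrictMono x := fun i j hij => (T'.orderEmbOfFin hcard).strictMono hij
  have hxmem : ∀ i, x i ∈ T := fun i => hT'T (T'.orderEmbOfFin_mem hcard i)
  have hxI : ∀ i, x i ∈ Ioo u v := fun i => (Finset.mem_filter.1 (hxmem i)).2
  have hxz : ∀ i, Wp.eval (x i) = 0 := by
    intro i
    have h := (Finset.mem_filter.1 (hxmem i)).1
    rw [Multiset.mem_toFinset, mem_roots hW0] at h
    exact h
  exact equalGap_ringfree_no_seven_zeros hm d e he₁ he₂ a hu hrow x hxmono hxI hxz

end ProductPlusOne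

end Summit.ValiantsHypothesis.ValiantsHypothesis.Theorems.LacunarySymmetroidMatrixDescartes
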